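import Summits.CriticalPhenomena.PercolationContinuityZ3.Theorems.Transplant.HexShadowGammaMin
import HarnessLib

/-!
# HEXAGONAL SHADOWS XXXI — the routing data of the local surgery, SWAP PAIRS, and the instance node `LocalLinkage`

builds on p205010 (kernel theorem, internal audit signed; external expert review pending) — NOT used in this file.  Lane `prim-bschramm`, seat
`prim-bschramm-p2` (gen 33; class C1b; memo `HOME/bschramm/P2-LATTICES.md` §120); helper file (`--supports stmt-CriticalPhenomena-4575 --as helper`).

WHY.  The remaining node of both hexagonal film rows is the ROUTING `HexShadow.HexLocatedSurgeries` («HexShadowFact2Reduction»): at almost every point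
`z ∈ U(ω)` the data `HexShadow.Surgery` («HexShadowSurgeryData») must be produced, and the only instance-dependent ingredient is DST's "three disjoint
self-avoiding paths in `\overline{B_R}(z) ∖ {z}`" (proof of Fact 2, p. 6) — here: a rerouting `E₁ :: P ++ [E₂]` of `γ_min` through the cleared block and a
branch `c :: Br` to `w'`.  The surgery also needs DST's order condition "`(z,v) ≺ (z,w)`": the successor `y` of the attachment vertex `c` must have a SMALLER
key than the first branch vertex `b` — for the tree's ARBITRARY enumeration `vtxKey V` («HexShadowGammaMin», a choice function), which no symmetry of an
instance respects.  The key-free form an instance can supply is a **SWAP PAIR**: two routings of the same terminals whose `(y, b)` are exchanged; whichever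
way the two keys compare, one of them satisfies the order condition (`exists_routeData_key`).
* §1 `HexShadow.RouteData Φ RP D E₁ E₂ w'` — the routing data (rerouted piece over `RP`, attachment vertex `c`, its successor `y`, branch over `D`), its
  elementary consequences, monotonicity in `RP`, `D`, and TRANSPORT along a graph automorphism covering a map of shadows (`RouteData.map`) — instances reduce
  the block positions by their lifted translations / rotations;
* §2 the clipped unit blocks `blk z t s = hexBall z 3 ∩ {w₀ ≤ z₀ + t} ∩ {w₀ + w₁ ≤ z₀ + z₁ + s}` and the instance node **`HexShadow.LocalLinkage Φ`**: for
  every block pair `RP = blk z t_R s_R ⊆ D = blk z t_D s_D` clipped in at most one direction, all terminals `E₁ ≠ E₂` over `RP ∩ hexSphere z 3` and `w'` over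
  `D` off the columns `z, sh E₁, sh E₂`, a swap pair of routings exists (an internal obligation on the instance, never asserted; true for `𝕋 × {0..k}`,
  `k ≥ 1`, and the `(111)`-films `F_k`, `k ≥ 3`; false for planar instances);
* §3 **`exists_routeData_key`**: under `LocalLinkage`, a routing with `vtxKey y < vtxKey b`.
[cite: DuminilCopinSidoraviciusTassion2016, §2.3 (proof of Fact 2, pp. 6–7: the radius R, the paths γ_u, γ_v, γ_w, "(z,v) ≺ (z,w)")] [cite: NewmanTassionWu2017, §3.2 (proof of Thm. 3.9)]
-/

noncomputable section

namespace Summit.CriticalPhenomena.PercolationContinuityZ3.Theorems.Transplant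

open MeasureTheory Literature.Probability.Percolation Literature.Probability.LatticeModels SimpleGraph Filter
open scoped Classical Topology

/-! ## §1 Routing data -/

/-- **The routing data of one local surgery** (DST's three disjoint paths, in the form `HexShadow.Surgery` consumes): the rerouted piece `P` — with
`E₁ :: P ++ [E₂]` a self-avoiding `G`-chain whose interior lies over `RP` —, the attachment vertex `c` with its successor `y` on that chain, and the branch
`Br ≠ []` — a self-avoiding `G`-chain `c :: Br` ending at `w'`, over `D`, off the rerouted chain.
[cite: DuminilCopinSidoraviciusTassion2016, §2.3, proof of Fact 2 (γ_u, γ_v, γ_w)] -/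
structure HexShadow.RouteData {V : Type} {G : SimpleGraph V} (Φ : HexShadow G) (RP D : Set (Site 2)) (E₁ E₂ w' : V) where
  /-- the rerouted piece, strictly between `E₁` and `E₂` -/
  P : List V
  /-- the attachment vertex -/
  c : V
  /-- the successor of `c` on `E₁ :: P ++ [E₂]` -/
  y : V
  /-- the branch, from a neighbour of `c` to `w'` -/
  Br : List V
  hP : ∀ x ∈ P, Φ.sh x ∈ RP
  hchain : (E₁ :: (P ++ [E₂])).IsChain (fun a b => G.Adj a b)
  hnodup : (E₁ :: (P ++ [E₂])).Nodup
  hy : ∃ l₁ l₂ : List V, E₁ :: (P ++ [E₂]) = l₁ ++ c :: y :: l₂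
  hBr : Br ≠ []
  hBrD : ∀ x ∈ Br, Φ.sh x ∈ D
  hBrchain : (c :: Br).IsChain (fun a b => G.Adj a b)
  hBrnodup : (c :: Br).Nodup
  hBrSP : ∀ x ∈ Br, x ∉ E₁ :: (P ++ [E₂])
  hBrlast : Br.getLast hBr = w'

namespace HexShadow.RouteData

variable {V : Type} {G : SimpleGraph V} {Φ : HexShadow G} {RP D : Set (Site 2)} {E₁ E₂ w' : V} (r : Φ.RouteData RP D E₁ E₂ w')

/-- The rerouted chain `E₁ :: P ++ [E₂]`. [cite: DuminilCopinSidoraviciusTassion2016, §2.3, proof of Fact 2] -/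
def SP : List V := E₁ :: (r.P ++ [E₂])

/-- The first branch vertex `b = Br.head`. [cite: DuminilCopinSidoraviciusTassion2016, §2.3, proof of Fact 2 (the vertex w)] -/
def b : V := r.Br.head r.hBr

/-- Two lists with a common duplicate-free decomposition point agree on the successor. [folklore] -/
theorem succ_unique {L : List V} (hL : L.Nodup) {c y y' : V} {l₁ l₂ l₁' l₂' : List V} (h : L = l₁ ++ c :: y :: l₂) (h' : L = l₁' ++ c :: y' :: l₂') :
    y = y' := by
  have hc : c ∉ l₁ := by
    intro hmem; rw [h, List.nodup_append] at hL; exact hL.2.2 c hmem c (by simp) rfl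
  have hc' : c ∉ l₁' := by
    intro hmem; rw [h', List.nodup_append] at hL; exact hL.2.2 c hmem c (by simp) rfl
  have key : ∀ (a a' : List V) (t t' : List V), c ∉ a → c ∉ a' → a ++ c :: t = a' ++ c :: t' → t = t' := by
    intro a
    induction a with
    | nil =>
      intro a' t t' _ ha' heq
      cases a' with
      | nil => simpa using heq
      | cons x xs => simp only [List.nil_append, List.cons_append, List.cons.injEq] at heq; exact absurd (heq.1 ▸ List.mem_cons_self) ha'
    | cons x xs ih =>
      intro a' t t' ha ha' heq
      cases a' with
      | nil => simp only [List.nil_append, List.cons_append, List.cons.injEq] at heq; exact absurd (heq.1 ▸ List.mem_cons_self) ha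
      | cons x' xs' =>
        simp only [List.cons_append, List.cons.injEq] at heq
        exact ih xs' t t' (fun hm => ha (List.mem_cons_of_mem _ hm)) (fun hm => ha' (List.mem_cons_of_mem _ hm)) heq.2
  have := key l₁ l₁' (y :: l₂) (y' :: l₂') hc hc' (h.symm.trans h')
  simpa using (List.cons.inj this).1

/-- **The order condition follows from the key comparison of `y` and `b`**: the successor of `c` on the rerouted chain is `y`. [folklore] -/
theorem hfwd_of_key [Countable V] (hkey : vtxKey V r.y < vtxKey V r.b) :
    ∀ (l₁ l₂ : List V) (y' : V), E₁ :: (r.P ++ [E₂]) = l₁ ++ r.c :: y' :: l₂ → vtxKey V y' < vtxKey V (r.Br.head r.hBr) := by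
  intro l₁ l₂ y' h
  obtain ⟨m₁, m₂, hm⟩ := r.hy
  rw [← succ_unique r.hnodup hm h]
  exact hkey

/-- A vertex with a successor in a duplicate-free list is not its last element. [folklore] -/
theorem ne_getLast_of_succ {L l₁ l₂ : List V} {c d : V} (h : L = l₁ ++ c :: d :: l₂) (hL : L.Nodup) (hne : L ≠ []) : c ≠ L.getLast hne := by
  intro hc
  have h1 : L.getLast hne = (d :: l₂).getLast (List.cons_ne_nil _ _) := by
    rw [List.getLast_congr _ (by simp) h, List.getLast_append_of_ne_nil _ (List.cons_ne_nil _ _), List.getLast_cons (List.cons_ne_nil _ _)]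
  have hmem : c ∈ d :: l₂ := by rw [hc, h1]; exact List.getLast_mem _
  rw [h, List.nodup_append] at hL
  exact (List.nodup_cons.1 hL.2.1).1 hmem

/-- `c` lies on `E₁ :: P` (it has a successor on the chain). [folklore] -/
theorem c_mem : r.c ∈ E₁ :: r.P := by
  obtain ⟨l₁, l₂, h⟩ := r.hy
  have hcSP : r.c ∈ E₁ :: (r.P ++ [E₂]) := by rw [h]; simp
  have hne : r.c ≠ E₂ := by
    have := ne_getLast_of_succ h r.hnodup (List.cons_ne_nil _ _)
    simpa using this
  simp only [List.mem_cons, List.mem_append, List.not_mem_nil, or_false] at hcSP ⊢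
  rcases hcSP with h1 | h1 | h1
  · exact Or.inl h1
  · exact Or.inr h1
  · exact absurd h1 hne

/-- `y` lies on the rerouted chain. [folklore] -/
theorem y_mem_SP : r.y ∈ E₁ :: (r.P ++ [E₂]) := by
  obtain ⟨l₁, l₂, h⟩ := r.hy; rw [h]; simp

/-- `b` lies on the branch. [folklore] -/
theorem b_mem_Br : r.b ∈ r.Br := List.head_mem _

/-- `c` and `y` are adjacent. [folklore] -/
theorem adj_c_y : G.Adj r.c r.y := by
  obtain ⟨l₁, l₂, h⟩ := r.hy
  have hch := r.hchain
  rw [h, List.isChain_append] at hch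
  exact (List.isChain_cons_cons.1 hch.2.1).1

/-- `c` and `b` are adjacent. [folklore] -/
theorem adj_c_b : G.Adj r.c r.b := by
  have hch := r.hBrchain
  obtain ⟨x, xs, hx⟩ := List.exists_cons_of_ne_nil r.hBr
  have hb : r.b = x := by simp [b, hx]
  rw [hx] at hch
  rw [hb]
  exact (List.isChain_cons_cons.1 hch).1

/-- `y ≠ b` (the branch is off the rerouted chain). [folklore] -/
theorem y_ne_b : r.y ≠ r.b := fun h => r.hBrSP _ r.b_mem_Br (h ▸ r.y_mem_SP)

/-- **Monotonicity**: routing data for `RP ⊆ RP'`, `D ⊆ D'`. [folklore] -/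
def mono {RP' D' : Set (Site 2)} (hRP : RP ⊆ RP') (hD : D ⊆ D') : Φ.RouteData RP' D' E₁ E₂ w' where
  P := r.P
  c := r.c
  y := r.y
  Br := r.Br
  hP := fun x hx => hRP (r.hP x hx)
  hchain := r.hchain
  hnodup := r.hnodup
  hy := r.hy
  hBr := r.hBr
  hBrD := fun x hx => hD (r.hBrD x hx)
  hBrchain := r.hBrchain
  hBrnodup := r.hBrnodup
  hBrSP := r.hBrSP
  hBrlast := r.hBrlast

/-- `mono` keeps `y`. [folklore] -/
@[simp] theorem mono_y {RP' D' : Set (Site 2)} (hRP : RP ⊆ RP') (hD : D ⊆ D') : (r.mono hRP hD).y = r.y := rfl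

/-- `mono` keeps `b`. [folklore] -/
@[simp] theorem mono_b {RP' D' : Set (Site 2)} (hRP : RP ⊆ RP') (hD : D ⊆ D') : (r.mono hRP hD).b = r.b := rfl

/-- **Transport along a graph automorphism covering a map of shadows**: if `sh (α v) = A (sh v)` for all `v`, `A` maps `RP` into `RP'` and `D` into `D'`,
routing data for `(E₁, E₂, w')` maps to routing data for `(α E₁, α E₂, α w')`. [folklore] -/
def map {W : Type} {G' : SimpleGraph W} {Ψ : HexShadow G'} (α : G ≃g G') (A : Site 2 → Site 2) (hA : ∀ v, Ψ.sh (α v) = A (Φ.sh v))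
    {RP' D' : Set (Site 2)} (hRP : ∀ q ∈ RP, A q ∈ RP') (hD : ∀ q ∈ D, A q ∈ D') : Ψ.RouteData RP' D' (α E₁) (α E₂) (α w') where
  P := r.P.map α
  c := α r.c
  y := α r.y
  Br := r.Br.map α
  hP := by
    intro x hx
    obtain ⟨v, hv, rfl⟩ := List.mem_map.1 hx
    rw [hA]; exact hRP _ (r.hP v hv)
  hchain := by
    have : α E₁ :: (r.P.map α ++ [α E₂]) = (E₁ :: (r.P ++ [E₂])).map α := by simp
    rw [this, List.isChain_map]
    exact r.hchain.imp fun a b h => α.map_adj_iff.2 h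
  hnodup := by
    have : α E₁ :: (r.P.map α ++ [α E₂]) = (E₁ :: (r.P ++ [E₂])).map α := by simp
    rw [this]
    exact r.hnodup.map α.injective
  hy := by
    obtain ⟨l₁, l₂, h⟩ := r.hy
    refine ⟨l₁.map α, l₂.map α, ?_⟩
    have : α E₁ :: (r.P.map α ++ [α E₂]) = (E₁ :: (r.P ++ [E₂])).map α := by simp
    rw [this, h]; simp
  hBr := by simpa using r.hBr
  hBrD := by
    intro x hx
    obtain ⟨v, hv, rfl⟩ := List.mem_map.1 hx
    rw [hA]; exact hD _ (r.hBrD v hv)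
  hBrchain := by
    have : α r.c :: r.Br.map α = (r.c :: r.Br).map α := by simp
    rw [this, List.isChain_map]
    exact r.hBrchain.imp fun a b h => α.map_adj_iff.2 h
  hBrnodup := by
    have : α r.c :: r.Br.map α = (r.c :: r.Br).map α := by simp
    rw [this]
    exact r.hBrnodup.map α.injective
  hBrSP := by
    intro x hx hmem
    obtain ⟨v, hv, rfl⟩ := List.mem_map.1 hx
    have : α E₁ :: (r.P.map α ++ [α E₂]) = (E₁ :: (r.P ++ [E₂])).map α := by simp
    rw [this, List.mem_map] at hmem
    obtain ⟨u, hu, huv⟩ := hmem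
    rw [α.injective huv] at hu
    exact r.hBrSP v hv hu
  hBrlast := by rw [List.getLast_map, r.hBrlast]

/-- `map` acts on `y` by `α`. [folklore] -/
@[simp] theorem map_y {W : Type} {G' : SimpleGraph W} {Ψ : HexShadow G'} (α : G ≃g G') (A : Site 2 → Site 2) (hA : ∀ v, Ψ.sh (α v) = A (Φ.sh v))
    {RP' D' : Set (Site 2)} (hRP : ∀ q ∈ RP, A q ∈ RP') (hD : ∀ q ∈ D, A q ∈ D') : (r.map α A hA hRP hD).y = α r.y := rfl

/-- `map` acts on `b` by `α`. [folklore] -/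
@[simp] theorem map_b {W : Type} {G' : SimpleGraph W} {Ψ : HexShadow G'} (α : G ≃g G') (A : Site 2 → Site 2) (hA : ∀ v, Ψ.sh (α v) = A (Φ.sh v))
    {RP' D' : Set (Site 2)} (hRP : ∀ q ∈ RP, A q ∈ RP') (hD : ∀ q ∈ D, A q ∈ D') : (r.map α A hA hRP hD).b = α r.b := by
  simp only [b, map]
  obtain ⟨x, xs, hx⟩ := List.exists_cons_of_ne_nil r.hBr
  simp [hx]

end HexShadow.RouteData

/-! ## §2 Clipped unit blocks and the instance node -/

/-- **The clipped unit block** `hexBall z 3 ∩ {w₀ ≤ z₀ + t} ∩ {w₀ + w₁ ≤ z₀ + z₁ + s}` (`t, s ≥ 3`: no clipping in that direction).  These are the cleared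
column sets of the local surgery: full hexagons inside `B_{3n}`, half-plane-clipped ones along the common side line of `B_{3n}` and `B'_n` and along the
upper-right side of `B_{3n}`. [cite: DuminilCopinSidoraviciusTassion2016, §2.3, proof of Fact 2 (the ball B_R(z))] -/
def blk (z : Site 2) (t s : ℕ) : Set (Site 2) := {w | w ∈ hexBall z 3 ∧ w 0 ≤ z 0 + t ∧ w 0 + w 1 ≤ z 0 + z 1 + s}

/-- Membership in a clipped block. [folklore] -/
@[simp] theorem mem_blk {z : Site 2} {t s : ℕ} {w : Site 2} : w ∈ blk z t s ↔ w ∈ hexBall z 3 ∧ w 0 ≤ z 0 + t ∧ w 0 + w 1 ≤ z 0 + z 1 + s := Iff.rfl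

/-- Clipped blocks lie in the unit hexagon of radius `3`. [folklore] -/
theorem blk_subset_hexBall (z : Site 2) (t s : ℕ) : blk z t s ⊆ hexBall z 3 := fun _ h => h.1

/-- Clipped blocks grow with the clipping parameters. [folklore] -/
theorem blk_mono (z : Site 2) {t t' s s' : ℕ} (ht : t ≤ t') (hs : s ≤ s') : blk z t s ⊆ blk z t' s' := by
  intro w hw
  exact ⟨hw.1, hw.2.1.trans (by omega), hw.2.2.trans (by omega)⟩

/-- With both parameters `≥ 3` the block is the full hexagon. [folklore] -/
theorem blk_eq_hexBall (z : Site 2) {t s : ℕ} (ht : 3 ≤ t) (hs : 3 ≤ s) : blk z t s = hexBall z 3 := by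
  ext w
  simp only [mem_blk, mem_hexBall, and_iff_left_iff_imp]
  intro hw
  have h0 := (abs_le_triNorm (w - z)).1
  have h2 : |(w - z) 0 + (w - z) 1| ≤ triNorm (w - z) := (le_max_right _ _).trans (le_max_right _ _)
  simp only [Pi.sub_apply] at h0 h2
  rw [abs_le] at h0 h2
  constructor <;> omega

/-- The centre lies in every block. [folklore] -/
theorem self_mem_blk (z : Site 2) (t s : ℕ) : z ∈ blk z t s := by
  exact ⟨by simp [mem_hexBall, triNorm], by omega, by omega⟩

/-- **NODE (instance obligation) — LOCAL LINKAGE in the clipped unit blocks** (DST 2016, §2.3, proof of Fact 2: "Fix `R` in such a way that for any site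
`z`, any three distinct neighbors `u, v, w` of `z` and any three distinct sites `u', v', w'` on the boundary of `\overline{B_R}(z)`, there exist three
disjoint self-avoiding paths in `\overline{B_R}(z) ∖ {z}` connecting `u` to `u'`, `v` to `v'` and `w` to `w'`", in the form the generic surgery consumes):
for every block pair `RP = blk z t_R s_R ⊆ D = blk z t_D s_D` clipped in at most one direction, all terminals `E₁ ≠ E₂` over `RP ∩ hexSphere z 3` (the first
and last visits of `γ_min` to `D̄`) and `w'` over `D` whose column is none of `z`, `sh E₁`, `sh E₂` (the exit of the `(P2)`-witness), there is a SWAP PAIR of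
routings: two `RouteData` with the successor of the attachment vertex and the first branch vertex exchanged.  An internal obligation on the instance, never
asserted (true for `𝕋 × {0..k}`, `k ≥ 1`, and for the `(111)`-films `F_k`, `k ≥ 3`; false for planar graphs).
[cite: DuminilCopinSidoraviciusTassion2016, §2.3 (proof of Fact 2, p. 6: the choice of R)] [cite: NewmanTassionWu2017, §3.2 (Def. 3.7)] -/
def HexShadow.LocalLinkage {V : Type} {G : SimpleGraph V} (Φ : HexShadow G) : Prop :=
  ∀ (z : Site 2) (tR tD sR sD : ℕ), tR ≤ tD → sR ≤ sD → (3 ≤ tR ∨ 3 ≤ sR) →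
    ∀ (E₁ E₂ w' : V), E₁ ≠ E₂ → Φ.sh E₁ ∈ blk z tR sR → Φ.sh E₁ ∈ hexSphere z 3 → Φ.sh E₂ ∈ blk z tR sR → Φ.sh E₂ ∈ hexSphere z 3 →
      Φ.sh w' ∈ blk z tD sD → Φ.sh w' ≠ z → Φ.sh w' ≠ Φ.sh E₁ → Φ.sh w' ≠ Φ.sh E₂ →
        ∃ r₁ r₂ : Φ.RouteData (blk z tR sR) (blk z tD sD) E₁ E₂ w', r₁.y = r₂.b ∧ r₁.b = r₂.y

/-! ## §3 The keyed routing from a swap pair -/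

namespace HexShadow

variable {V : Type} {G : SimpleGraph V} (Φ : HexShadow G)

/-- **From a swap pair, a routing satisfying DST's order condition for the tree's enumeration**: one of the two routings has `vtxKey y < vtxKey b`.
[cite: DuminilCopinSidoraviciusTassion2016, §2.3, proof of Fact 2 ("(z,v) ≺ (z,w)")] -/
theorem exists_routeData_key [Countable V] {RP D : Set (Site 2)} {E₁ E₂ w' : V} (r₁ r₂ : Φ.RouteData RP D E₁ E₂ w') (h1 : r₁.y = r₂.b) (h2 : r₁.b = r₂.y) :
    ∃ r : Φ.RouteData RP D E₁ E₂ w', vtxKey V r.y < vtxKey V r.b := by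
  rcases lt_or_ge (vtxKey V r₁.y) (vtxKey V r₁.b) with h | h
  · exact ⟨r₁, h⟩
  · refine ⟨r₂, lt_of_le_of_ne (by rw [← h1, ← h2]; exact h) fun heq => ?_⟩
    exact r₂.y_ne_b (vtxKey_injective V heq)

/-- **The keyed routing under `LocalLinkage`.** [cite: DuminilCopinSidoraviciusTassion2016, §2.3, proof of Fact 2] -/
theorem exists_routeData_of_localLinkage [Countable V] (hL : Φ.LocalLinkage) (z : Site 2) {tR tD sR sD : ℕ} (htRD : tR ≤ tD) (hsRD : sR ≤ sD)
    (hone : 3 ≤ tR ∨ 3 ≤ sR) {E₁ E₂ w' : V} (hne : E₁ ≠ E₂) (h1 : Φ.sh E₁ ∈ blk z tR sR) (h1s : Φ.sh E₁ ∈ hexSphere z 3) (h2 : Φ.sh E₂ ∈ blk z tR sR)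
    (h2s : Φ.sh E₂ ∈ hexSphere z 3) (h3 : Φ.sh w' ∈ blk z tD sD) (h3z : Φ.sh w' ≠ z) (h31 : Φ.sh w' ≠ Φ.sh E₁) (h32 : Φ.sh w' ≠ Φ.sh E₂) :
    ∃ r : Φ.RouteData (blk z tR sR) (blk z tD sD) E₁ E₂ w', vtxKey V r.y < vtxKey V r.b := by
  obtain ⟨r₁, r₂, hy, hb⟩ := hL z tR tD sR sD htRD hsRD hone E₁ E₂ w' hne h1 h1s h2 h2s h3 h3z h31 h32
  exact Φ.exists_routeData_key r₁ r₂ hy hb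

end HexShadow

end Summit.CriticalPhenomena.PercolationContinuityZ3.Theorems.Transplant

end
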